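import Summits.CriticalPhenomena.PercolationContinuityZ3.Theorems.PercNearOneGluingNoHeavyPcintUFibBipCheck
import HarnessLib

/-!
# PCINT lane, T-fibre route PHASE 2, instance `d = 8`: rows 0–10 of the tail table of `K_{10,10}` at `p = 0.2252`

Cell `prim-pcint`, seat `prim-pcint-1` (gen 12); memo `run/shared/lean/prim/pcint/T-FIBRE-ROUTE.md` (PHASE 2).
Kernel computations only (`decide +kernel` on `UFib.checkRow` / `UFib.checkCells`, exact rational arithmetic), split over
files to respect the per-file elaboration budget; this last part assembles `UFib.checkBip_8`.
-/

namespace Summit.CriticalPhenomena.PercolationContinuityZ3.Theorems.Pcint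

namespace UFib

/-- Row `ha = 0` of the tail table of `K_{10,10}` at `p = 0.2252` (kernel, exact rational arithmetic). -/
theorem checkRow_8_0 : checkRow 10 10 0 (2252 / 10000) (5001 / 10000) = true := by decide +kernel

/-- Row `ha = 1` of the tail table of `K_{10,10}` at `p = 0.2252` (kernel, exact rational arithmetic). -/
theorem checkRow_8_1 : checkRow 10 10 1 (2252 / 10000) (5001 / 10000) = true := by decide +kernel

/-- Row `ha = 2` of the tail table of `K_{10,10}` at `p = 0.2252` (kernel, exact rational arithmetic). -/
theorem checkRow_8_2 : checkRow 10 10 2 (2252 / 10000) (5001 / 10000) = true := by decide +kernel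

/-- Row `ha = 3` of the tail table of `K_{10,10}` at `p = 0.2252` (kernel, exact rational arithmetic). -/
theorem checkRow_8_3 : checkRow 10 10 3 (2252 / 10000) (5001 / 10000) = true := by decide +kernel

/-- Row `ha = 4` of the tail table of `K_{10,10}` at `p = 0.2252` (kernel, exact rational arithmetic). -/
theorem checkRow_8_4 : checkRow 10 10 4 (2252 / 10000) (5001 / 10000) = true := by decide +kernel

/-- Row `ha = 5` of the tail table of `K_{10,10}` at `p = 0.2252` (kernel, exact rational arithmetic). -/
theorem checkRow_8_5 : checkRow 10 10 5 (2252 / 10000) (5001 / 10000) = true := by decide +kernel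

/-- Row `ha = 6` of the tail table of `K_{10,10}` at `p = 0.2252` (kernel, exact rational arithmetic). -/
theorem checkRow_8_6 : checkRow 10 10 6 (2252 / 10000) (5001 / 10000) = true := by decide +kernel

/-- Row `ha = 7` of the tail table of `K_{10,10}` at `p = 0.2252` (kernel, exact rational arithmetic). -/
theorem checkRow_8_7 : checkRow 10 10 7 (2252 / 10000) (5001 / 10000) = true := by decide +kernel

/-- Row `ha = 8` of the tail table of `K_{10,10}` at `p = 0.2252` (kernel, exact rational arithmetic). -/
theorem checkRow_8_8 : checkRow 10 10 8 (2252 / 10000) (5001 / 10000) = true := by decide +kernel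

/-- Row `ha = 9` of the tail table of `K_{10,10}` at `p = 0.2252` (kernel, exact rational arithmetic). -/
theorem checkRow_8_9 : checkRow 10 10 9 (2252 / 10000) (5001 / 10000) = true := by decide +kernel

/-- Row `ha = 10` of the tail table of `K_{10,10}` at `p = 0.2252` (kernel, exact rational arithmetic). -/
theorem checkRow_8_10 : checkRow 10 10 10 (2252 / 10000) (5001 / 10000) = true := by decide +kernel

/-- **The tail table of `K_{10,10}` at `p = 0.2252`, `s = 0.5001`**, checked by the kernel in exact rational arithmetic. -/
theorem checkBip_8 : checkBip 10 10 (2252 / 10000) (5001 / 10000) = true :=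
  checkBip_of_rows fun ha hha => by
    interval_cases ha
    exacts [checkRow_8_0, checkRow_8_1, checkRow_8_2, checkRow_8_3, checkRow_8_4, checkRow_8_5, checkRow_8_6, checkRow_8_7, checkRow_8_8, checkRow_8_9, checkRow_8_10]

end UFib

end Summit.CriticalPhenomena.PercolationContinuityZ3.Theorems.Pcint
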